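import Literature.MathematicalPhysics.QuantumFieldTheory.Balaban1983to89.B9Eq365TowerGpSquaredLadder
import Literature.MathematicalPhysics.QuantumFieldTheory.Balaban1983to89.B9Eq376POneLetters

/-!
# `Balaban1983to89.B9Eq365TowerXOperatorLadder` — T. Bałaban, *Propagators for lattice gauge theories in a background field*, Commun. Math. Phys. **99** (1985) 389–434
# [Balaban1985BackgroundPropagators] (3.65)–(3.66) p. 403 («Q′(U′U)G′²(U′U)Q′*(U′U) = Q′(U)G′²(U)Q′*(U) + C′(A) … |C′(A; y, y′)| ≦ O(1)α₁ … e^{−½δ₀d(y,y′)}»), (3.19) p. 393, (3.24) p. 394,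
# (3.57)–(3.59) pp. 401–402, Thm 3.1 (3.42) p. 397, with [Balaban1984PropagatorsII] (2.51)–(2.55) p. 232, (2.66) p. 234: **THE TWO-BACKGROUND LADDER FOR THE WORD `Q′G′²Q′*` OF THE
# THIRD OPERATOR AT THE NE9 CHAIN's LETTERS, LATTICE-UNIFORMLY, ON THE `𝔸`-VALUED COARSE CARRIER** — in pv08's two-block-map calculus (`B6RandomWalkHom`, coarse carrier WITH FIBRE
# `TSite d m × ι`, block map `(y, i) ↦ y`; r06's scalar-model FILES 17∕27 do not type this, lineage memo `ROUTE-Jprime-LOCATED-g99.md` §L1): the word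
# `W(U) = conjHom b (kerOp blkK k_Q(U)) ∘ conj b (readA φ G′_k(U)²) ∘ conjHom b (liftOp blkK s_Q(U))` (= print's `Q′(U)G′²(U)Q′*(U)` read in `𝔸`, realified; the identification with the
# chain's `Q̃′_kG′_k²Q̃′_k†` is this lineage's `B9Eq319QprimeTowerHomMajorants`) satisfies `W(U) − W(1) ≺ K_X·α·e^{−δ_X d}` with `α_X, K_X, δ_X` BEFORE `n, η, m, U` — print's `C′(A)` bound (3.66)
# at the base `U₀ = 1`, from `W(U) − W(1) = F′₂G′²(U)Q′*(U) + Q′(1)(G′²(U) − G′²(1))Q′*(U) + Q′(1)G′²(1)F′₂*` with the BLOCK-DIAGONAL letters `k_Q, k_F, s_Q, s_F` (exact compositions, no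
# (2.61)) and the `G′²`-ladder `B9Eq365TowerGpSquaredLadder`

statement-level skeleton of published theorems with citation tags; proofs where landed; nothing here is a claim about the Yang–Mills mass gap

CITATION HEADER (lean-in-tree rule).  Audit cell `pub-balaban`, sub-cell `t4`, BINDER row NE9; NE9 crux-team LEAF PROVER 01 (`b2b-balaban-t4-ne9-formalise-leaf-01`,
gen 99; bears_on: R4/N22).  Vocabulary BY NAME: pv08's `B6RandomWalkHom.HasMajorantHom` ∕ `hasMajorantHom_comp` ∕ `hasMajorantHom_mono` ∕ `hasMajorantHom_add` ∕ `hasMajorantHom_iff`,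
`B6RandomWalk.majorant_G0_mul_265` ∕ `hasMajorant_add` ∕ `hasMajorant_mono` ∕ `c1_nonneg`, `B4Sect5Proof.weaken`; r06's `B9Eq376POneLetters.conjHom` ∕ `conjHom_apply` ∕ `conjHom_sub`,
`B9Eq352DivFormLetters.conj` ∕ `conj_mul` ∕ `coordEquiv_symm_apply` ∕ `norm_coordSymm_apply_le`, `B9Eq360Vprime.kerOp` ∕ `liftOp`; this lineage's `B9Eq357QprimeTowerKernelForm` (`blkK`, `kQ`,
`norm_kQ_le`, `card_block_blkK_mul_inv_eq_one`, `kerOp_add_kernel`, `norm_adTransport_le_of_norm_le_one`), `B9Eq324PenaltyKernelForm` (`sQ`, `readA`, `readA_comp`, `norm_sQ_le`),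
`B9Eq358TowerKernelSizes`, `B9Eq341TowerBlockGeometry`, `B9Eq342TowerFlatBaseMajorants.exists_hasMajorants_GpOfUk_one` ∕ `norm_adTransportW_UlevOf_one_le`,
`B9Eq365TowerGpSquaredLadder.exists_hasMajorant_GpOfUk_sq_sub_flat`.  Sources read through those files' verbatim quotations: [Balaban1985BackgroundPropagators] pp. 393–394, 397, 401–403;
[Balaban1984PropagatorsII] pp. 232, 234.  [folklore] finite sums and the ring identity `AGS − A₁G₁S₁ = (A−A₁)GS + A₁(G−G₁)S + A₁G₁(S−S₁)`; COMPOSITION BY NAME; NOTHING of print's proofs is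
reproduced beyond what the named files prove.

WHAT IS PROVED (sorry-free; proof lane — no `def`).
* §1 BLOCK-DIAGONAL LETTERS: **`hasMajorantHom_kerOp_ind`** (`conjHom b (kerOp blkK k) ≺ 𝟙[y = y′]·C·M₂(Σ‖b_i‖)` for `‖k(y, x)‖ ≤ C(L^{n+1})^{−d}` on the block),
  **`hasMajorantHom_liftOp_ind`** (`conjHom b (liftOp blkK s) ≺ 𝟙[y = y′]·C·M₂(Σ‖b_i‖)` for `‖s(x)‖ ≤ C`), and the exact compositions **`hasMajorantHom_comp_ind_left`**,
  **`hasMajorantHom_comp_ind_right`** (a block-diagonal factor multiplies the other majorant by its constant).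
* §2 **`exists_hasMajorantHom_X_sub_flat`** — `∃ α_X > 0, K_X ≥ 0, δ_X > 0` BEFORE the lattice: on print's small-field class of the ladder files (plus fibre-isometric level transporters),
  ANY positivity witnesses, ANY `M, R_r, H`: `HasMajorantHom (toB6 (towerGeom …) R_r H) (·.1) (·.1) (W(U) − W(1)) (fun a a′ => K_X·α·e^{−δ_X·d(a,a′)})`.
HONEST SCOPE.  Bookkeeping on top of the ladder files; constants crude (NOT print's); the Thm-3.1 inputs behind the ladder are the cell's MODEL rows («NE9 ⇐ the named binders»; O-NE9-1, #5
UNRULED); NOT the inverse `(Q̃′G′²Q̃′†)⁻¹` itself (the resolvent step with leaf-03's `B9Eq349ConjugatedQGGQInvSupRowTower` rows is the NEXT brick), NOT `R_k`, NOT the bond `G_k`; NE9 NOT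
PRINTED ∕ NOT PROVED; spine PROVED 0∕9; rung (B)+1 finite T⁴ — NOT infinite volume, NOT mass gap, NOT BetaPertH, NOT Clay.  HONEST DEPENDENCY: continuum YM on T⁴ ⇐ BetaPertH ∧ nine spine
estimates (0/9 proved); BetaPertH ⇐ (D1) ∧ (D4) ∧ CAP+tail; G-an2-4 gates asym, D1 and NE2/3/4.  NEW file; nothing modified.  Net new unproved facts: 0.
-/

noncomputable section

open scoped BigOperators InnerProductSpace

namespace Literature.MathematicalPhysics.QuantumFieldTheory.Balaban1983to89.B9Eq365TowerXOperatorLadder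

open B4Sect5Torus (TSite)
open B7Prop1Explicit (U1)
open B9SectCLatticeCarrier (Bond shift)
open B9Eq311L2Pairing (WL2)
open B11Eq103H1Complex (SiteL2K)
open B9Eq310HessianOperator (adTransportW)
open B9Eq315QTower (towerP UlevOf)
open B9Eq33CovDerivVector (adTransport)
open B9Eq324DeltaPrimeATower (laplacePrimeAk GpOfUk)
open B6RandomWalk (HasMajorant hasMajorant_mono hasMajorant_add majorant_G0_mul_265 c1_nonneg)
open B6RandomWalkHom (HasMajorantHom hasMajorantHom_comp hasMajorantHom_mono hasMajorantHom_add hasMajorantHom_iff)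
open B4Sect5Proof (weaken)
open B9Thm34Ext (toB6)
open B9Eq352DivFormLetters (conj coordEquiv coordEquiv_symm_apply norm_coordSymm_apply_le)
open B9Eq376POneLetters (conjHom conjHom_apply conjHom_sub)
open B9Eq360Vprime (kerOp kerOp_apply liftOp liftOp_apply mem_block)
open B9Eq357QprimeTowerKernelForm (blkK kQ norm_kQ_le card_block_blkK_mul_inv_eq_one kerOp_add_kernel norm_adTransport_le_of_norm_le_one)
open B9Eq324PenaltyKernelForm (sQ readA readA_comp norm_sQ_le)
open B9Eq358TowerKernelSizes (kQ_flatLevels_eq norm_kF_le_of_class norm_sF_le_of_class exp_window_sub_one_le)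
open B9Eq341TowerBlockGeometry (towerGeom len_towerGeom htri_towerGeom h261_towerGeom hdnn_towerGeom)
open B9Eq342TowerFlatBaseMajorants (exists_hasMajorants_GpOfUk_one norm_adTransportW_UlevOf_one_le)
open B9Eq365TowerGpSquaredLadder (exists_hasMajorant_GpOfUk_sq_sub_flat)

/-! ## §1 Block-diagonal two-space letters and their exact compositions -/

section Letters

variable {d : ℕ} (L : ℕ) [NeZero L] (m : Fin d → ℕ) [∀ i, NeZero (m i)] (n : ℕ) (η M : ℝ)
  {𝔸 : Type*} [NormedRing 𝔸] [NormedAlgebra ℂ 𝔸]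
  {ι : Type} [Fintype ι] (b : Module.Basis ι ℝ 𝔸) {M₂ : ℝ} (hM₂ : 0 ≤ M₂) (hrepr : ∀ (v : 𝔸) (i : ι), |b.repr v i| ≤ M₂ * ‖v‖)
  (Rr : ℝ) (H : Prop)

/-- The row computation of a big-block kernel operator: `‖(kerOp k f)(v)‖ ≤ C·B′` when `‖k(v, x)‖ ≤ C(L^{n+1})^{−d}` and `‖f(x)‖ ≤ B′` on the block of `v` (`|B(v)|(L^{n+1})^{−d} = 1`).
[cite: Balaban1985BackgroundPropagators, (3.19) p.393] -/
theorem norm_kerOp_apply_le (k : TSite d m → TSite d (towerP L m (n + 1)) → 𝔸 →L[ℝ] 𝔸) {C : ℝ} (hC : 0 ≤ C)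
    (hk : ∀ y x, blkK L m n x = y → ‖k y x‖ ≤ C * (((L : ℝ) ^ (n + 1)) ^ d)⁻¹) (f : TSite d (towerP L m (n + 1)) → 𝔸) (v : TSite d m) {B' : ℝ}
    (hf : ∀ x, blkK L m n x = v → ‖f x‖ ≤ B') : ‖kerOp (blkK L m n) k f v‖ ≤ C * B' := by
  rw [kerOp_apply]
  calc ‖∑ x ∈ B9Eq360Vprime.block (blkK L m n) v, k v x (f x)‖ ≤ ∑ x ∈ B9Eq360Vprime.block (blkK L m n) v, ‖k v x (f x)‖ := norm_sum_le _ _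
    _ ≤ ∑ x ∈ B9Eq360Vprime.block (blkK L m n) v, C * (((L : ℝ) ^ (n + 1)) ^ d)⁻¹ * B' := Finset.sum_le_sum fun x hx => by
        have hx' : blkK L m n x = v := (mem_block _ _ _).1 hx
        exact (ContinuousLinearMap.le_opNorm _ _).trans (mul_le_mul (hk v x hx') (hf x hx') (norm_nonneg _) (by positivity))
    _ = C * (((B9Eq360Vprime.block (blkK L m n) v).card : ℝ) * (((L : ℝ) ^ (n + 1)) ^ d)⁻¹) * B' := by rw [Finset.sum_const, nsmul_eq_mul]; ring
    _ = C * B' := by rw [card_block_blkK_mul_inv_eq_one, mul_one]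

include hM₂ hrepr in
/-- **A BIG-BLOCK KERNEL OPERATOR IS BLOCK-DIAGONAL IN REAL COORDINATES**: `conjHom b (kerOp blkK k) ≺ 𝟙[y = y′]·C·M₂(Σ_i‖b_i‖)` (fine block map `(x, i) ↦ y_x`, coarse `(y, i) ↦ y`) when
`‖k(y, x)‖ ≤ C(L^{n+1})^{−d}` on the block. [cite: Balaban1985BackgroundPropagators, (3.19) p.393, Thm 3.1 (3.42) p.397; Balaban1984PropagatorsII, (2.51) p.232] -/
theorem hasMajorantHom_kerOp_ind (k : TSite d m → TSite d (towerP L m (n + 1)) → 𝔸 →L[ℝ] 𝔸) {C : ℝ} (hC : 0 ≤ C)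
    (hk : ∀ y x, blkK L m n x = y → ‖k y x‖ ≤ C * (((L : ℝ) ^ (n + 1)) ^ d)⁻¹) :
    HasMajorantHom (g := toB6 (towerGeom L m n η M) Rr H) (fun p : TSite d (towerP L m (n + 1)) × ι => blkK L m n p.1) (fun q : TSite d m × ι => q.1)
      (conjHom b (kerOp (blkK L m n) k)) (fun a a' : TSite d m => if a = a' then C * (M₂ * ∑ i, ‖b i‖) else 0) := by
  intro y' μ B hμ q
  rw [conjHom_apply]
  dsimp only
  split_ifs with hq
  · have hf : ∀ x, blkK L m n x = q.1 → ‖(coordEquiv b).symm μ x‖ ≤ (∑ i, ‖b i‖) * B := fun x hx =>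
      norm_coordSymm_apply_le b μ x B fun i => hμ.bound (x, i) (hx.trans hq)
    have h1 := norm_kerOp_apply_le L m n k hC hk ((coordEquiv b).symm μ) q.1 hf
    calc |b.repr (kerOp (blkK L m n) k ((coordEquiv b).symm μ) q.1) q.2| ≤ M₂ * ‖kerOp (blkK L m n) k ((coordEquiv b).symm μ) q.1‖ := hrepr _ _
      _ ≤ M₂ * (C * ((∑ i, ‖b i‖) * B)) := mul_le_mul_of_nonneg_left h1 hM₂
      _ = C * (M₂ * ∑ i, ‖b i‖) * B := by ring
  · have h0 : kerOp (blkK L m n) k ((coordEquiv b).symm μ) q.1 = 0 := by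
      rw [kerOp_apply]
      refine Finset.sum_eq_zero fun x hx => ?_
      have hx' : blkK L m n x = q.1 := (mem_block _ _ _).1 hx
      have hfx : (coordEquiv b).symm μ x = 0 := by
        rw [coordEquiv_symm_apply]
        exact Finset.sum_eq_zero fun i _ => by rw [hμ.off (x, i) (fun h => hq (hx'.symm.trans h)), zero_smul]
      rw [hfx, map_zero]
    rw [h0, map_zero, Finsupp.zero_apply, abs_zero, zero_mul]

include hM₂ hrepr in
omit [NeZero L] in
/-- **A BIG-BLOCK LIFT IS BLOCK-DIAGONAL IN REAL COORDINATES**: `conjHom b (liftOp blkK s) ≺ 𝟙[y = y′]·C·M₂(Σ_i‖b_i‖)` (coarse `(y, i) ↦ y`, fine `(x, i) ↦ y_x`) when `‖s(x)‖ ≤ C`.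
[cite: Balaban1985BackgroundPropagators, (3.24) p.394, Thm 3.1 (3.42) p.397; Balaban1984PropagatorsII, (2.51) p.232] -/
theorem hasMajorantHom_liftOp_ind (s : TSite d (towerP L m (n + 1)) → 𝔸 →L[ℝ] 𝔸) {C : ℝ} (hC : 0 ≤ C) (hs : ∀ x, ‖s x‖ ≤ C) :
    HasMajorantHom (g := toB6 (towerGeom L m n η M) Rr H) (fun q : TSite d m × ι => q.1) (fun p : TSite d (towerP L m (n + 1)) × ι => blkK L m n p.1)
      (conjHom b (liftOp (blkK L m n) s)) (fun a a' : TSite d m => if a = a' then C * (M₂ * ∑ i, ‖b i‖) else 0) := by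
  intro y' μ B hμ p
  rw [conjHom_apply, liftOp_apply]
  dsimp only
  split_ifs with hp
  · have hν : ‖(coordEquiv b).symm μ (blkK L m n p.1)‖ ≤ (∑ i, ‖b i‖) * B :=
      norm_coordSymm_apply_le b μ (blkK L m n p.1) B fun i => hμ.bound (blkK L m n p.1, i) hp
    calc |b.repr (s p.1 ((coordEquiv b).symm μ (blkK L m n p.1))) p.2| ≤ M₂ * ‖s p.1 ((coordEquiv b).symm μ (blkK L m n p.1))‖ := hrepr _ _
      _ ≤ M₂ * (C * ((∑ i, ‖b i‖) * B)) :=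
          mul_le_mul_of_nonneg_left ((ContinuousLinearMap.le_opNorm _ _).trans (mul_le_mul (hs _) hν (norm_nonneg _) hC)) hM₂
      _ = C * (M₂ * ∑ i, ‖b i‖) * B := by ring
  · have hν : (coordEquiv b).symm μ (blkK L m n p.1) = 0 := by
      rw [coordEquiv_symm_apply]
      exact Finset.sum_eq_zero fun i _ => by rw [hμ.off (blkK L m n p.1, i) hp, zero_smul]
    rw [hν, map_zero, map_zero, Finsupp.zero_apply, abs_zero, zero_mul]

omit [NeZero L] in
/-- **EXACT COMPOSITION WITH A BLOCK-DIAGONAL LEFT FACTOR**: `T₁ ≺ 𝟙[a = a′]·c`, `T₂ ≺ K₂` (`K₂ ≥ 0`) ⟹ `T₁ ∘ T₂ ≺ c·K₂` (the middle partition (2.52) collapses).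
[cite: Balaban1984PropagatorsII, (2.52)–(2.55) p.232] -/
theorem hasMajorantHom_comp_ind_left {X Y Z : Type} (blkX : X → TSite d m) (blkY : Y → TSite d m) (blkZ : Z → TSite d m)
    {T₁ : (Y → ℝ) →ₗ[ℝ] (Z → ℝ)} {T₂ : (X → ℝ) →ₗ[ℝ] (Y → ℝ)} {c : ℝ} {K₂ : TSite d m → TSite d m → ℝ}
    (h₁ : HasMajorantHom (g := toB6 (towerGeom L m n η M) Rr H) blkY blkZ T₁ (fun a a' : TSite d m => if a = a' then c else 0))
    (h₂ : HasMajorantHom (g := toB6 (towerGeom L m n η M) Rr H) blkX blkY T₂ K₂) (hK₂ : ∀ a a', 0 ≤ K₂ a a') :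
    HasMajorantHom (g := toB6 (towerGeom L m n η M) Rr H) blkX blkZ (T₁ ∘ₗ T₂) (fun a a' => c * K₂ a a') := by
  refine hasMajorantHom_mono _ _ (hasMajorantHom_comp (g := toB6 (towerGeom L m n η M) Rr H) blkX blkY blkZ h₁ h₂ hK₂)
    fun (a a' : TSite d m) => le_of_eq ?_
  show ∑ y'' : TSite d m, (if a = y'' then c else 0) * K₂ y'' a' = c * K₂ a a'
  simp only [ite_mul, zero_mul, Finset.sum_ite_eq, Finset.mem_univ, if_true]

omit [NeZero L] in
/-- **EXACT COMPOSITION WITH A BLOCK-DIAGONAL RIGHT FACTOR**: `T₁ ≺ K₁`, `T₂ ≺ 𝟙[a = a′]·c` (`c ≥ 0`) ⟹ `T₁ ∘ T₂ ≺ K₁·c`. [cite: Balaban1984PropagatorsII, (2.52)–(2.55) p.232] -/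
theorem hasMajorantHom_comp_ind_right {X Y Z : Type} (blkX : X → TSite d m) (blkY : Y → TSite d m) (blkZ : Z → TSite d m)
    {T₁ : (Y → ℝ) →ₗ[ℝ] (Z → ℝ)} {T₂ : (X → ℝ) →ₗ[ℝ] (Y → ℝ)} {K₁ : TSite d m → TSite d m → ℝ} {c : ℝ}
    (h₁ : HasMajorantHom (g := toB6 (towerGeom L m n η M) Rr H) blkY blkZ T₁ K₁)
    (h₂ : HasMajorantHom (g := toB6 (towerGeom L m n η M) Rr H) blkX blkY T₂ (fun a a' : TSite d m => if a = a' then c else 0)) (hc : 0 ≤ c) :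
    HasMajorantHom (g := toB6 (towerGeom L m n η M) Rr H) blkX blkZ (T₁ ∘ₗ T₂) (fun a a' => K₁ a a' * c) := by
  have hK₂ : ∀ a a' : TSite d m, 0 ≤ (fun a a' : TSite d m => if a = a' then c else 0) a a' := fun a a' => by
    show 0 ≤ (if a = a' then c else 0)
    split_ifs
    · exact hc
    · exact le_rfl
  refine hasMajorantHom_mono _ _ (hasMajorantHom_comp (g := toB6 (towerGeom L m n η M) Rr H) blkX blkY blkZ h₁ h₂ hK₂)
    fun (a a' : TSite d m) => le_of_eq ?_
  show ∑ y'' : TSite d m, K₁ a y'' * (if y'' = a' then c else 0) = K₁ a a' * c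
  simp only [mul_ite, mul_zero, Finset.sum_ite_eq', Finset.mem_univ, if_true]

end Letters

/-! ## §2 The word `Q′G′²Q′*` at the chain's letters: the two-background ladder -/

section Main

variable {d : ℕ} (L : ℕ) [NeZero L] {𝔸 : Type*} [NormedRing 𝔸] [NormedAlgebra ℂ 𝔸] [CompleteSpace 𝔸] [NormOneClass 𝔸] [StarRing 𝔸] [FiniteDimensional ℂ 𝔸]
  {W : Type*} [NormedAddCommGroup W] [InnerProductSpace ℂ W] [FiniteDimensional ℂ W] (φ : W ≃ₗ[ℂ] 𝔸) {a' Mφ Mφ' : ℝ}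
  (hMφ : 0 ≤ Mφ) (hMφ' : 0 ≤ Mφ') (hφn : ∀ w, ‖φ w‖ ≤ Mφ * ‖w‖) (hφn' : ∀ X, ‖φ.symm X‖ ≤ Mφ' * ‖X‖) (ha' : 0 < a')
  {r : ℝ} (hr0 : 0 ≤ r) (hr1 : r < 1)
  (τ : 𝔸 →ₗ[ℂ] ℂ) (hτ₂ : ∀ X Y : 𝔸, τ (X * Y) = τ (Y * X)) (hφτ : ∀ X Y : 𝔸, ⟪φ.symm X, φ.symm Y⟫_ℂ = τ (star X * Y))
  {ι : Type} [Fintype ι] [DecidableEq ι] (b : Module.Basis ι ℝ 𝔸) {M₂ : ℝ} (hM₂ : 0 ≤ M₂) (hrepr : ∀ (v : 𝔸) (i : ι), |b.repr v i| ≤ M₂ * ‖v‖)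

include hMφ hMφ' hφn hφn' ha' hr0 hr1 hτ₂ hφτ hM₂ hrepr in
/-- **THE TWO-BACKGROUND LADDER FOR THE WORD `Q′G′²Q′*`, LATTICE-UNIFORMLY** (see the module docstring): `W(U) − W(1) ≺ K_X·α·e^{−δ_X d}` on the coarse carrier with fibre, block map
`(y, i) ↦ y`, for every background of print's small-field class (plus fibre-isometric level transporters), `α ≤ α_X`, the constants chosen BEFORE `n, η, m, U`.
[cite: Balaban1985BackgroundPropagators, (3.65)–(3.66) p.403, (3.57)–(3.59) pp.401–402, Thm 3.1 (3.42) p.397; Balaban1984PropagatorsII, (2.52)–(2.55) p.232, (2.66) p.234] -/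
theorem exists_hasMajorantHom_X_sub_flat (hd : 1 ≤ d) (hL3 : 3 ≤ L) :
    ∃ αX KX δX : ℝ, 0 < αX ∧ 0 ≤ KX ∧ 0 < δX ∧
      ∀ (n : ℕ) (η : ℝ), η * (L : ℝ) ^ (n + 1) = 1 →
      ∀ (c₀ c₁ : ℝ) [Fact (0 < c₀)] [Fact (0 < c₁)], c₀ * ((L : ℝ) ^ (n + 1)) ^ d = c₁ →
      ∀ (m : Fin d → ℕ) [∀ i, NeZero (m i)] (U : Bond d (towerP L m (n + 1)) → 𝔸ˣ) (α : ℝ), 0 ≤ α → α ≤ αX →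
        (∀ bd, U bd ∈ U1 𝔸) → (∀ bd, ‖(U bd : 𝔸) - 1‖ ≤ α * η) →
        (∀ (x : TSite d (towerP L m (n + 1))) (μ ν : Fin d), ‖(U (shift ν x, μ) : 𝔸) - (U (x, μ) : 𝔸)‖ ≤ α * η ^ 2) →
      ∀ (εU : ℕ → ℝ), (∀ j, 0 ≤ εU j) → (∀ j, εU j ≤ 1) → (∀ j < n + 1, εU j ≤ α * r ^ j) →
        (∀ (j : ℕ) (bd : Bond d (towerP L m (j + 1))), ‖(UlevOf L m (n + 1) U j bd : 𝔸) - 1‖ ≤ εU j) →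
        (∀ (j : ℕ) (bd : Bond d (towerP L m (j + 1))), UlevOf L m (n + 1) U j bd ∈ U1 𝔸) →
        (∀ (j : ℕ) (bd : Bond d (towerP L m (j + 1))) (w : W), ‖adTransportW φ (UlevOf L m (n + 1) U j) bd w‖ ≤ ‖w‖) →
      ∀ (hposU : ∀ x : SiteL2K ℂ d (towerP L m (n + 1)) c₀ W, x ≠ 0 → 0 < RCLike.re ⟪x, laplacePrimeAk L m n φ η U a' (c₁ := c₁) x⟫_ℂ)
        (hpos₁ : ∀ x : SiteL2K ℂ d (towerP L m (n + 1)) c₀ W, x ≠ 0 →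
          0 < RCLike.re ⟪x, laplacePrimeAk L m n φ η (fun _ : Bond d (towerP L m (n + 1)) => (1 : 𝔸ˣ)) a' (c₁ := c₁) x⟫_ℂ)
        (M Rr : ℝ) (H : Prop),
      HasMajorantHom (g := toB6 (towerGeom L m n η M) Rr H) (fun q : TSite d m × ι => q.1) (fun q : TSite d m × ι => q.1)
        (conjHom b (kerOp (blkK L m n) (kQ L m n (fun j => adTransport (𝕜 := ℂ) (UlevOf L m (n + 1) U j)))) ∘ₗ
            conj b (readA φ (GpOfUk L m n φ η U a' (c₁ := c₁) hposU ∘ₗ GpOfUk L m n φ η U a' (c₁ := c₁) hposU)) ∘ₗ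
              conjHom b (liftOp (blkK L m n) (sQ L m n φ U (c₀ := c₀) (c₁ := c₁))) -
          conjHom b (kerOp (blkK L m n) (kQ L m n (fun j => adTransport (𝕜 := ℂ)
              (UlevOf L m (n + 1) (fun _ : Bond d (towerP L m (n + 1)) => (1 : 𝔸ˣ)) j)))) ∘ₗ
            conj b (readA φ (GpOfUk L m n φ η (fun _ : Bond d (towerP L m (n + 1)) => (1 : 𝔸ˣ)) a' (c₁ := c₁) hpos₁ ∘ₗ
                GpOfUk L m n φ η (fun _ : Bond d (towerP L m (n + 1)) => (1 : 𝔸ˣ)) a' (c₁ := c₁) hpos₁)) ∘ₗ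
              conjHom b (liftOp (blkK L m n) (sQ L m n φ (fun _ : Bond d (towerP L m (n + 1)) => (1 : 𝔸ˣ)) (c₀ := c₀) (c₁ := c₁))))
        (fun a a' => KX * α * Real.exp (-(δX * (towerGeom L m n η M).dist a a'))) := by
  obtain ⟨αJ, KJ, δJ, hαJ, hKJ, hδJ, Hsq⟩ :=
    exists_hasMajorant_GpOfUk_sq_sub_flat L φ hMφ hMφ' hφn hφn' ha' hr0 hr1 τ hτ₂ hφτ b hM₂ hrepr hd hL3
  obtain ⟨BG, δ₀, hBG, hδ₀, hbase⟩ := exists_hasMajorants_GpOfUk_one L φ (a' := a') hMφ hMφ' hφn hφn' ha' τ hτ₂ hφτ b hM₂ hrepr hd hL3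
  -- the lattice-free constants
  have hSb : 0 ≤ ∑ i, ‖b i‖ := Finset.sum_nonneg fun i _ => norm_nonneg _
  set κ : ℝ := M₂ * ∑ i, ‖b i‖ with hκ
  have hκ0 : 0 ≤ κ := mul_nonneg hM₂ hSb
  set ck : ℝ := ((d * (L - 1) : ℕ) : ℝ) * (3 / (1 - r)) with hck
  have hck0 : 0 ≤ ck := mul_nonneg (Nat.cast_nonneg _) (div_nonneg (by norm_num) (by linarith))
  set cs : ℝ := ((d * (L - 1) : ℕ) : ℝ) * (2 * Mφ * Mφ' / (1 - r)) with hcs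
  have hcs0 : 0 ≤ cs := mul_nonneg (Nat.cast_nonneg _) (div_nonneg (by positivity) (by linarith))
  set cKF : ℝ := ck * Real.exp (ck * (1 / 16)) with hcKF
  set cSF : ℝ := Mφ * Mφ' * (cs * Real.exp (cs * (1 / 16))) with hcSF
  have hδm0 : 0 < min (δ₀ / 2) δJ := lt_min (by linarith) hδJ
  have hc1 : 0 ≤ B6.c1 d δ₀ (1 / 2) := c1_nonneg d _ _
  set K2f : ℝ := BG * B6.c1 d δ₀ (1 / 2) * 1 * BG with hK2f
  set K2U : ℝ := K2f + KJ * αJ with hK2U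
  have hcKF0 : 0 ≤ cKF := by rw [hcKF]; positivity
  have hcSF0 : 0 ≤ cSF := by rw [hcSF]; positivity
  have hK2f0 : 0 ≤ K2f := by rw [hK2f]; positivity
  have hK2U0 : 0 ≤ K2U := by rw [hK2U]; positivity
  refine ⟨min αJ (1 / 16), cKF * κ * (K2U * (Mφ * Mφ' * κ)) + 1 * κ * (KJ * (Mφ * Mφ' * κ)) + 1 * κ * (K2f * (cSF * κ)), min (δ₀ / 2) δJ,
    lt_min hαJ (by norm_num), by positivity, hδm0, ?_⟩
  intro n η hη c₀ c₁ _ _ hc m _ U α hα0 hαle hU1 hUs hUw εU hε0 hε1 hεr hlev hlev1 hRlev hposU hpos₁ M Rr H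
  have hαJ' : α ≤ αJ := hαle.trans (min_le_left _ _)
  have hα16 : α ≤ 1 / 16 := hαle.trans (min_le_right _ _)
  have hD := Hsq n η hη c₀ c₁ hc m U α hα0 hαJ' hU1 hUs hUw εU hε0 hε1 hεr hlev hlev1 hposU hpos₁ M Rr H
  have hF := (hbase n η hη c₀ c₁ hc m hpos₁ M Rr H).1
  have hlen1 : ∀ a : (towerGeom L m n η M).Site, (towerGeom L m n η M).len a = 1 := fun a => by
    rw [len_towerGeom, mul_comm]; exact hη
  have hdnn := hdnn_towerGeom L m n η M
  have hc₀ : (0 : ℝ) < c₀ := Fact.out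
  have hLp : ((L : ℝ) ^ (n + 1)) ^ d ≠ 0 := pow_ne_zero _ (pow_ne_zero _ (Nat.cast_ne_zero.mpr (NeZero.ne L)))
  have hw1 : (c₁ / c₀) * (((L : ℝ) ^ (n + 1)) ^ d)⁻¹ = 1 := by rw [← hc]; field_simp
  -- (1) the block-diagonal letters: k_Q(U) − k_Q(1) = k_F, k_Q(1), s_Q(U), s_Q(U) − s_Q(1) = s_F
  have hkF : ∀ y x, blkK L m n x = y →
      ‖(kQ L m n (fun j => adTransport (𝕜 := ℂ) (UlevOf L m (n + 1) U j)) - kQ L m n (fun _ _ => (LinearMap.id : 𝔸 →ₗ[ℂ] 𝔸))) y x‖ ≤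
        cKF * α * (((L : ℝ) ^ (n + 1)) ^ d)⁻¹ := fun y x _ => by
    refine (norm_kF_le_of_class L m n U εU hε0 hε1 hlev hlev1 hr0 hr1 hα0 hεr y x).trans ?_
    have e1 : ((d * (L - 1) : ℕ) : ℝ) * (3 * α / (1 - r)) = ck * α := by rw [hck]; ring
    rw [e1, hcKF]
    exact mul_le_mul_of_nonneg_right (exp_window_sub_one_le hck0 hα0 hα16) (by positivity)
  have hker : conjHom b (kerOp (blkK L m n) (kQ L m n (fun j => adTransport (𝕜 := ℂ) (UlevOf L m (n + 1) U j)))) -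
        conjHom b (kerOp (blkK L m n) (kQ L m n (fun j => adTransport (𝕜 := ℂ)
          (UlevOf L m (n + 1) (fun _ : Bond d (towerP L m (n + 1)) => (1 : 𝔸ˣ)) j)))) =
      conjHom b (kerOp (blkK L m n) (kQ L m n (fun j => adTransport (𝕜 := ℂ) (UlevOf L m (n + 1) U j)) -
        kQ L m n (fun _ _ => (LinearMap.id : 𝔸 →ₗ[ℂ] 𝔸)))) := by
    rw [← conjHom_sub, kQ_flatLevels_eq]
    refine congrArg (conjHom b) (LinearMap.ext fun μ => ?_)
    rw [LinearMap.sub_apply, sub_eq_iff_eq_add, ← kerOp_add_kernel, sub_add_cancel]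
  have hAF : HasMajorantHom (g := toB6 (towerGeom L m n η M) Rr H) (fun p : TSite d (towerP L m (n + 1)) × ι => blkK L m n p.1)
      (fun q : TSite d m × ι => q.1)
      (conjHom b (kerOp (blkK L m n) (kQ L m n (fun j => adTransport (𝕜 := ℂ) (UlevOf L m (n + 1) U j)))) -
        conjHom b (kerOp (blkK L m n) (kQ L m n (fun j => adTransport (𝕜 := ℂ)
          (UlevOf L m (n + 1) (fun _ : Bond d (towerP L m (n + 1)) => (1 : 𝔸ˣ)) j)))))
      (fun a a'' : TSite d m => if a = a'' then cKF * α * κ else 0) := by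
    rw [hker]
    exact hasMajorantHom_kerOp_ind L m n η M b hM₂ hrepr Rr H _ (mul_nonneg hcKF0 hα0) hkF
  have hA1 : HasMajorantHom (g := toB6 (towerGeom L m n η M) Rr H) (fun p : TSite d (towerP L m (n + 1)) × ι => blkK L m n p.1)
      (fun q : TSite d m × ι => q.1)
      (conjHom b (kerOp (blkK L m n) (kQ L m n (fun j => adTransport (𝕜 := ℂ)
          (UlevOf L m (n + 1) (fun _ : Bond d (towerP L m (n + 1)) => (1 : 𝔸ˣ)) j)))))
      (fun a a'' : TSite d m => if a = a'' then 1 * κ else 0) := by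
    rw [kQ_flatLevels_eq]
    exact hasMajorantHom_kerOp_ind L m n η M b hM₂ hrepr Rr H _ zero_le_one fun y x _ => by
      rw [one_mul]; exact norm_kQ_le L m n _ (fun _ _ v => le_rfl) y x
  have hsU : ∀ x, ‖sQ L m n φ U (c₀ := c₀) (c₁ := c₁) x‖ ≤ Mφ * Mφ' := fun x =>
    (norm_sQ_le L m n φ (c₀ := c₀) (c₁ := c₁) U hMφ hMφ' hφn hφn' hRlev x).trans (le_of_eq (by rw [hw1, mul_one]))
  have hSU : HasMajorantHom (g := toB6 (towerGeom L m n η M) Rr H) (fun q : TSite d m × ι => q.1)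
      (fun p : TSite d (towerP L m (n + 1)) × ι => blkK L m n p.1)
      (conjHom b (liftOp (blkK L m n) (sQ L m n φ U (c₀ := c₀) (c₁ := c₁)))) (fun a a'' : TSite d m => if a = a'' then Mφ * Mφ' * κ else 0) :=
    hasMajorantHom_liftOp_ind L m n η M b hM₂ hrepr Rr H _ (mul_nonneg hMφ hMφ') hsU
  have hsF : ∀ x, ‖(sQ L m n φ U (c₀ := c₀) (c₁ := c₁) - sQ L m n φ (fun _ : Bond d (towerP L m (n + 1)) => (1 : 𝔸ˣ)) (c₀ := c₀) (c₁ := c₁)) x‖ ≤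
      cSF * α := fun x => by
    rw [Pi.sub_apply]
    refine (norm_sF_le_of_class L m n φ U εU hε0 hlev hlev1 hr0 hr1 hα0 hεr hMφ hMφ' hφn hφn' x).trans ?_
    have e1 : ((d * (L - 1) : ℕ) : ℝ) * (2 * Mφ * Mφ' * α / (1 - r)) = cs * α := by rw [hcs]; ring
    rw [e1]
    have hexp := exp_window_sub_one_le hcs0 hα0 hα16
    calc Mφ * Mφ' * ((c₁ / c₀) * ((Real.exp (cs * α) - 1) * (((L : ℝ) ^ (n + 1)) ^ d)⁻¹))
          = Mφ * Mφ' * (Real.exp (cs * α) - 1) * ((c₁ / c₀) * (((L : ℝ) ^ (n + 1)) ^ d)⁻¹) := by ring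
      _ = Mφ * Mφ' * (Real.exp (cs * α) - 1) := by rw [hw1, mul_one]
      _ ≤ Mφ * Mφ' * (cs * Real.exp (cs * (1 / 16)) * α) := mul_le_mul_of_nonneg_left hexp (mul_nonneg hMφ hMφ')
      _ = cSF * α := by rw [hcSF]; ring
  have hlift : conjHom b (liftOp (blkK L m n) (sQ L m n φ U (c₀ := c₀) (c₁ := c₁))) -
        conjHom b (liftOp (blkK L m n) (sQ L m n φ (fun _ : Bond d (towerP L m (n + 1)) => (1 : 𝔸ˣ)) (c₀ := c₀) (c₁ := c₁))) =
      conjHom b (liftOp (blkK L m n) (sQ L m n φ U (c₀ := c₀) (c₁ := c₁) -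
        sQ L m n φ (fun _ : Bond d (towerP L m (n + 1)) => (1 : 𝔸ˣ)) (c₀ := c₀) (c₁ := c₁))) := by
    rw [← conjHom_sub]
    refine congrArg (conjHom b) (LinearMap.ext fun ν => funext fun x => ?_)
    rw [LinearMap.sub_apply, Pi.sub_apply, liftOp_apply, liftOp_apply, liftOp_apply, Pi.sub_apply, sub_apply]
  have hSF : HasMajorantHom (g := toB6 (towerGeom L m n η M) Rr H) (fun q : TSite d m × ι => q.1)
      (fun p : TSite d (towerP L m (n + 1)) × ι => blkK L m n p.1)
      (conjHom b (liftOp (blkK L m n) (sQ L m n φ U (c₀ := c₀) (c₁ := c₁))) -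
        conjHom b (liftOp (blkK L m n) (sQ L m n φ (fun _ : Bond d (towerP L m (n + 1)) => (1 : 𝔸ˣ)) (c₀ := c₀) (c₁ := c₁))))
      (fun a a'' : TSite d m => if a = a'' then cSF * α * κ else 0) := by
    rw [hlift]
    exact hasMajorantHom_liftOp_ind L m n η M b hM₂ hrepr Rr H _ (mul_nonneg hcSF0 hα0) hsF
  -- (2) the fine propagator words: `G′(1)²` and `G′(U)² = G′(1)² + (G′(U)² − G′(1)²)` at the common rate
  have hF1 : HasMajorant (g := toB6 (towerGeom L m n η M) Rr H) (fun p : TSite d (towerP L m (n + 1)) × ι => blkK L m n p.1)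
      (conj b (readA φ (GpOfUk L m n φ η (fun _ : Bond d (towerP L m (n + 1)) => (1 : 𝔸ˣ)) a' (c₁ := c₁) hpos₁)))
      (fun a a'' => BG * (1 : ℝ) * Real.exp (-(δ₀ * (towerGeom L m n η M).dist a a''))) :=
    hasMajorant_mono _ hF fun a a'' => by rw [hlen1 a, one_pow]
  have hF2 : HasMajorant (g := toB6 (towerGeom L m n η M) Rr H) (fun p : TSite d (towerP L m (n + 1)) × ι => blkK L m n p.1)
      (conj b (readA φ (GpOfUk L m n φ η (fun _ : Bond d (towerP L m (n + 1)) => (1 : 𝔸ˣ)) a' (c₁ := c₁) hpos₁)))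
      (fun a a'' => BG * Real.exp (-((1 - 1 / 2) * δ₀ * (towerGeom L m n η M).dist a a''))) :=
    hasMajorant_mono _ hF fun a a'' => by
      rw [hlen1 a, one_pow, mul_one]
      exact weaken hBG.le le_rfl (by linarith) (hdnn a a'')
  have hG1sq : HasMajorant (g := toB6 (towerGeom L m n η M) Rr H) (fun p : TSite d (towerP L m (n + 1)) × ι => blkK L m n p.1)
      (conj b (readA φ (GpOfUk L m n φ η (fun _ : Bond d (towerP L m (n + 1)) => (1 : 𝔸ˣ)) a' (c₁ := c₁) hpos₁ ∘ₗ
        GpOfUk L m n φ η (fun _ : Bond d (towerP L m (n + 1)) => (1 : 𝔸ˣ)) a' (c₁ := c₁) hpos₁)))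
      (fun a a'' => K2f * Real.exp (-(min (δ₀ / 2) δJ * (towerGeom L m n η M).dist a a''))) := by
    rw [readA_comp, B9Eq352DivFormLetters.conj_mul]
    have hP := majorant_G0_mul_265 (g := toB6 (towerGeom L m n η M) Rr H) (fun p : TSite d (towerP L m (n + 1)) × ι => blkK L m n p.1) d δ₀ (1 / 2)
      BG BG (fun _ => (1 : ℝ)) hBG.le (fun _ => zero_le_one) hBG.le (by linarith) (htri_towerGeom L m n η M Rr H)
      (h261_towerGeom L m n η M Rr H (by norm_num : (0 : ℝ) < 1 / 2) hδ₀) hF1 hF2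
    refine hasMajorant_mono _ hP fun a a'' => ?_
    rw [hK2f]
    exact weaken (by positivity) le_rfl (by linarith [min_le_left (δ₀ / 2) δJ]) (hdnn a a'')
  have hD' : HasMajorant (g := toB6 (towerGeom L m n η M) Rr H) (fun p : TSite d (towerP L m (n + 1)) × ι => blkK L m n p.1)
      (conj b (readA φ (GpOfUk L m n φ η U a' (c₁ := c₁) hposU ∘ₗ GpOfUk L m n φ η U a' (c₁ := c₁) hposU)) -
        conj b (readA φ (GpOfUk L m n φ η (fun _ : Bond d (towerP L m (n + 1)) => (1 : 𝔸ˣ)) a' (c₁ := c₁) hpos₁ ∘ₗ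
          GpOfUk L m n φ η (fun _ : Bond d (towerP L m (n + 1)) => (1 : 𝔸ˣ)) a' (c₁ := c₁) hpos₁)))
      (fun a a'' => KJ * α * Real.exp (-(min (δ₀ / 2) δJ * (towerGeom L m n η M).dist a a''))) :=
    hasMajorant_mono _ hD fun a a'' => weaken (mul_nonneg hKJ hα0) le_rfl (min_le_right _ _) (hdnn a a'')
  have hGU : HasMajorant (g := toB6 (towerGeom L m n η M) Rr H) (fun p : TSite d (towerP L m (n + 1)) × ι => blkK L m n p.1)
      (conj b (readA φ (GpOfUk L m n φ η U a' (c₁ := c₁) hposU ∘ₗ GpOfUk L m n φ η U a' (c₁ := c₁) hposU)))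
      (fun a a'' => K2U * Real.exp (-(min (δ₀ / 2) δJ * (towerGeom L m n η M).dist a a''))) := by
    have hsum := hasMajorant_add _ hG1sq hD'
    rw [add_sub_cancel] at hsum
    refine hasMajorant_mono _ hsum fun a a'' => ?_
    have he := Real.exp_nonneg (-(min (δ₀ / 2) δJ * (towerGeom L m n η M).dist a a''))
    have : KJ * α ≤ KJ * αJ := mul_le_mul_of_nonneg_left hαJ' hKJ
    rw [hK2U]
    nlinarith
  -- (3) the algebra and the three exact compositions
  generalize conjHom b (kerOp (blkK L m n) (kQ L m n (fun j => adTransport (𝕜 := ℂ) (UlevOf L m (n + 1) U j)))) = AU at hAF ⊢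
  generalize conjHom b (kerOp (blkK L m n) (kQ L m n (fun j => adTransport (𝕜 := ℂ)
    (UlevOf L m (n + 1) (fun _ : Bond d (towerP L m (n + 1)) => (1 : 𝔸ˣ)) j)))) = A1 at hAF hA1 ⊢
  generalize conj b (readA φ (GpOfUk L m n φ η U a' (c₁ := c₁) hposU ∘ₗ GpOfUk L m n φ η U a' (c₁ := c₁) hposU)) = GU at hD' hGU ⊢
  generalize conj b (readA φ (GpOfUk L m n φ η (fun _ : Bond d (towerP L m (n + 1)) => (1 : 𝔸ˣ)) a' (c₁ := c₁) hpos₁ ∘ₗ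
    GpOfUk L m n φ η (fun _ : Bond d (towerP L m (n + 1)) => (1 : 𝔸ˣ)) a' (c₁ := c₁) hpos₁)) = G1 at hD' hG1sq ⊢
  generalize conjHom b (liftOp (blkK L m n) (sQ L m n φ U (c₀ := c₀) (c₁ := c₁))) = SU at hSU hSF ⊢
  generalize conjHom b (liftOp (blkK L m n) (sQ L m n φ (fun _ : Bond d (towerP L m (n + 1)) => (1 : 𝔸ˣ)) (c₀ := c₀) (c₁ := c₁))) = S1 at hSF ⊢
  have hsplit : AU ∘ₗ GU ∘ₗ SU - A1 ∘ₗ G1 ∘ₗ S1 = (AU - A1) ∘ₗ (GU ∘ₗ SU) + (A1 ∘ₗ ((GU - G1) ∘ₗ SU) + A1 ∘ₗ (G1 ∘ₗ (SU - S1))) := by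
    simp only [LinearMap.sub_comp, LinearMap.comp_sub]; abel
  rw [hsplit]
  have hMκ : 0 ≤ Mφ * Mφ' * κ := by positivity
  -- term 1: F′₂ ∘ (G′(U)² ∘ Q′*(U))
  have hT1 := hasMajorantHom_comp_ind_left L m n η M Rr H (fun q : TSite d m × ι => q.1) (fun p : TSite d (towerP L m (n + 1)) × ι => blkK L m n p.1)
    (fun q : TSite d m × ι => q.1) hAF
    (hasMajorantHom_comp_ind_right L m n η M Rr H (fun q : TSite d m × ι => q.1) (fun p : TSite d (towerP L m (n + 1)) × ι => blkK L m n p.1)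
      (fun p : TSite d (towerP L m (n + 1)) × ι => blkK L m n p.1) ((hasMajorantHom_iff _ _ _).2 hGU) hSU hMκ)
    (fun a a'' => mul_nonneg (mul_nonneg hK2U0 (Real.exp_nonneg _)) hMκ)
  -- term 2: Q′(1) ∘ ((G′(U)² − G′(1)²) ∘ Q′*(U))
  have hT2 := hasMajorantHom_comp_ind_left L m n η M Rr H (fun q : TSite d m × ι => q.1) (fun p : TSite d (towerP L m (n + 1)) × ι => blkK L m n p.1)
    (fun q : TSite d m × ι => q.1) hA1
    (hasMajorantHom_comp_ind_right L m n η M Rr H (fun q : TSite d m × ι => q.1) (fun p : TSite d (towerP L m (n + 1)) × ι => blkK L m n p.1)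
      (fun p : TSite d (towerP L m (n + 1)) × ι => blkK L m n p.1) ((hasMajorantHom_iff _ _ _).2 hD') hSU hMκ)
    (fun a a'' => mul_nonneg (mul_nonneg (mul_nonneg hKJ hα0) (Real.exp_nonneg _)) hMκ)
  -- term 3: Q′(1) ∘ (G′(1)² ∘ F′₂*)
  have hT3 := hasMajorantHom_comp_ind_left L m n η M Rr H (fun q : TSite d m × ι => q.1) (fun p : TSite d (towerP L m (n + 1)) × ι => blkK L m n p.1)
    (fun q : TSite d m × ι => q.1) hA1
    (hasMajorantHom_comp_ind_right L m n η M Rr H (fun q : TSite d m × ι => q.1) (fun p : TSite d (towerP L m (n + 1)) × ι => blkK L m n p.1)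
      (fun p : TSite d (towerP L m (n + 1)) × ι => blkK L m n p.1) ((hasMajorantHom_iff _ _ _).2 hG1sq) hSF (mul_nonneg (mul_nonneg hcSF0 hα0) hκ0))
    (fun a a'' => mul_nonneg (mul_nonneg hK2f0 (Real.exp_nonneg _)) (mul_nonneg (mul_nonneg hcSF0 hα0) hκ0))
  refine hasMajorantHom_mono _ _ (hasMajorantHom_add _ _ hT1 (hasMajorantHom_add _ _ hT2 hT3)) fun a a'' => le_of_eq ?_
  dsimp only
  ring

end Main

end Literature.MathematicalPhysics.QuantumFieldTheory.Balaban1983to89.B9Eq365TowerXOperatorLadder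

end
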